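import Mathlib
import Summits.ResolutionOfSingularities.ResolutionOfSingularities.Theorems.WildQuotientsWildQuotientResolutionBlowupExitVertexPresentation

/-!
# The cone-brick transfer, DEPTH TWO: the scheme → ring reduction of the `μ₄` brick `HP₀` of RUNG V5
(crux stmt-ResolutionOfSingularities-15640 `WildQuotients.WildQuotientResolution`, line `Sketch`;
chain w45c RUNG V5 (`L/w45c/CHAIN.md` v8.2 §0: «HP₀ = stub-4, RULING 11:40Z β: reduced centres,
binder unchanged, two-level toric package»), scaffold `JordanFive.jordanFive_hasResolution_of_bricks`
(p527978) brick `HP₀`; [OURS · L1 W4.5c] — generic glue, NOT a statement of any manuscript.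
Lead prover res-L1-w45c-lead-1.)

The depth-two twins of `exists_isBlowup_regular_of_invariantsPresentation` (p503610) and
`exists_isBlowup_regular_of_vertexPresentation` (p505172). Setting as there: `ρ` an action of the
finite group `G` on `X → S` over an AFFINE base, `O` a `G`-stable open affine over `S`,
`ψ : R →+* Γ(O)` injective onto the invariants. NEW: besides the equations `𝔞 ⊆ Γ(O)` of the FIRST
centre (radical identity `√(ψ⁻¹⟨𝔞⟩) = J₀`, `J₀` radical — but NO regularity of `Bl_{J₀}` asked) a
second set `𝔞' ⊆ Γ(O)` (the vertex locus over which the second centre lies, `√(ψ⁻¹⟨𝔞'⟩) = J₀'`),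
a closed `C₀ ⊆ Bl_{J₀}(Spec R)` lying over `V(J₀')`, and SOME blow-up of `Bl_{J₀}(Spec R)` along
the REDUCED ideal sheaf of `C₀` regular. CONCLUSION: exactly the depth-two brick shape of
`ToricExit.toricExitTransfer₄` (p525488) / `HP₀`:
`∃ B pB, IsBlowup pB 𝓘_Z ∧ ∃ C : Closeds B, pB '' C ⊆ q(V(𝔞')) ∧ ∃ B' p', IsBlowup p' 𝓘_C ∧ IsRegular B'`
(with `B := Bl_{J₀}(Spec R)` moved along `Spec R ≅ O/G`, `C := C₀`).

* `exists_iso_spec_pieceQuot_zeroLocus` — the comparison `E : Spec R ≅ O/G` together with the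
  DICTIONARY `E⁻¹(q(V(𝔞))) = V(ψ⁻¹⟨𝔞⟩)` for EVERY `𝔞 ⊆ Γ(O)` (lying over; the p503610 argument made
  reusable);
* `exists_isBlowup_depthTwo_of_invariantsPresentation` — the transfer;
* `exists_isBlowup_depthTwo_of_vertexPresentation` — with both loci given as vertex loci
  `π⁻¹V(F₀) ∖ ⋃_j V[⊤, y_j]` of a blowing up `π : V → Spec S` (first: `j ∈ κ`, second: `j ∈ κ'`),
  their equations being `π^*F₀ ∪ {T_j}` by `preimage_ι_vertexLocus_eq_zeroLocus_spec` (p504270) —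
  LITERALLY the binder `HP₀` of p527978 (`κ = {j ∉ {0,2,5,13}}` the edge surface, `κ' = {j ≠ 0}` the
  `μ₄` vertex curve).
-/

-- single-problem summit: the doubled namespace component `ResolutionOfSingularities` is forced
set_option linter.dupNamespace false

noncomputable section

open CategoryTheory AlgebraicGeometry TopologicalSpace
open Literature.AlgebraicGeometry.Resolution Literature.AlgebraicGeometry.RelativeSpec

namespace Summit.ResolutionOfSingularities.ResolutionOfSingularities.Theorems.WildQuotientResolution.BlowupExit

set_option maxHeartbeats 800000 in
/-- **`Spec R ≅ O/G` from a presentation of the invariant ring, with the zero-locus dictionary**: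
for `ψ : R → Γ(O)` injective onto `Γ(O)^G` there is `E : Spec R ≅ O/G` such that for EVERY
`𝔞 ⊆ Γ(O)` the preimage under `E` of the image of `V(𝔞) ⊆ O` in `O/G` is `V(ψ⁻¹⟨𝔞⟩) ⊆ Spec R`
(lying over for the integral extension `Γ(O)^G ⊆ Γ(O)`). [OURS · L1 W4.5c] [folklore] -/
theorem exists_iso_spec_pieceQuot_zeroLocus {X S : Scheme.{0}} {r : X ⟶ S}
    {G : Type} [Group G] [Finite G] (ρ : ActionOver r G) [S.IsSeparated] [IsSeparated r]
    [IsAffine S] (O : ρ.StableAffineOpens) {R : Type} [CommRing R]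
    (ψ : R →+* Γ((O.1 : Scheme.{0}), (O.1.ι ≫ r) ⁻¹ᵁ ⊤)) (hψ : Function.Injective ψ)
    (hrange : ψ.range = (ρ.restrict O.1 O.2.1).invariantsRing ⊤) :
    ∃ E : Spec (CommRingCat.of R) ≅ ρ.pieceQuot O, ∀ 𝔞 : Set Γ((O.1 : Scheme.{0}), (O.1.ι ≫ r) ⁻¹ᵁ ⊤),
      E.hom.base ⁻¹' ((ρ.pieceMk O).base '' ((O.1 : Scheme.{0}).zeroLocus 𝔞)) =
        PrimeSpectrum.zeroLocus (((Ideal.span 𝔞).comap ψ : Ideal R) : Set R) := by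
  classical
  -- the action on `Γ(O)` and the invariance structure `Γ(O)^G ⊆ Γ(O)`
  letI := (ρ.restrict O.1 O.2.1).mulSemiringAction ⊤
  haveI := (ρ.restrict O.1 O.2.1).isInvariant_invariantsRing ⊤
  -- notation
  let XO : Scheme.{0} := (O.1 : Scheme.{0})
  let U' : XO.Opens := (O.1.ι ≫ r) ⁻¹ᵁ ⊤
  let Γ_O : Type := Γ(XO, U')
  let Inv : Subring Γ_O := (ρ.restrict O.1 O.2.1).invariantsRing ⊤
  -- `O` is affine, `U' = ⊤` is an affine open and `U'.toSpecΓ` is an isomorphism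
  haveI : IsAffineHom (O.1.ι ≫ r) := O.2.2
  haveI : IsAffine XO := isAffine_of_isAffineHom (O.1.ι ≫ r)
  have hU'top : U' = ⊤ := Scheme.Hom.preimage_top _
  have hU'aff : IsAffineOpen U' := by rw [hU'top]; exact isAffineOpen_top XO
  -- the quotient piece is the spectrum of the invariants
  obtain ⟨e, he⟩ := exists_iso_spec_pieceQuot ρ O
  -- `R ≅ Γ(O)^G`
  have hmem : ∀ x : R, ψ x ∈ Inv := fun x => by
    change ψ x ∈ ((ρ.restrict O.1 O.2.1).invariantsRing ⊤ : Subring Γ_O)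
    rw [← hrange]; exact ⟨x, rfl⟩
  let ψ₀ : R →+* Inv := ψ.codRestrict Inv hmem
  have hψ₀ : Function.Bijective ψ₀ := by
    refine ⟨fun x y hxy => hψ (congrArg Subtype.val hxy :), fun y => ?_⟩
    have hy : (y : Γ_O) ∈ ψ.range := by rw [hrange]; exact y.2
    obtain ⟨x, hx⟩ := hy
    exact ⟨x, Subtype.ext hx⟩
  let ψ' : R ≃+* Inv := RingEquiv.ofBijective ψ₀ hψ₀
  have hψ' : ∀ x : R, ((ψ' x : Inv) : Γ_O) = ψ x := fun x => rfl
  -- `Γ(O)` is integral over the invariants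
  haveI : Algebra.IsIntegral Inv Γ_O :=
    Algebra.IsInvariant.isIntegral ((ρ.restrict O.1 O.2.1).invariantsRing ⊤)
      Γ((O.1 : Scheme.{0}), (O.1.ι ≫ r) ⁻¹ᵁ ⊤) G
  -- the isomorphism `E : Spec R ≅ O/G`
  let sR : Spec (CommRingCat.of R) ⟶ Spec (CommRingCat.of Inv) :=
    Spec.map (CommRingCat.ofHom (ψ'.symm : Inv →+* R))
  haveI : IsIso sR := by
    have : IsIso (CommRingCat.ofHom (ψ'.symm : Inv →+* R)) :=
      (ψ'.symm.toCommRingCatIso).isIso_hom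
    exact inferInstance
  refine ⟨asIso sR ≪≫ e, fun 𝔞 => ?_⟩
  -- the preimage of `q(V(𝔞))` in `Spec Γ(O)^G` is `V(𝔞 ∩ Γ(O)^G)`
  have hZe : e.hom.base ⁻¹' ((ρ.pieceMk O).base '' (XO.zeroLocus 𝔞)) =
      PrimeSpectrum.zeroLocus (((Ideal.span 𝔞).comap (algebraMap Inv Γ_O) : Ideal Inv) : Set Inv) := by
    have hsurj : Function.Surjective U'.ι.base := by
      intro x
      exact ⟨⟨x, by rw [hU'top]; trivial⟩, rfl⟩
    have hcomp : ∀ x : (U' : Scheme.{0}), (ρ.pieceMk O).base (U'.ι.base x) =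
        e.hom.base ((Spec.map (CommRingCat.ofHom Inv.subtype)).base (U'.toSpecΓ.base x)) := by
      intro x
      have h : (U'.ι ≫ ρ.pieceMk O) x =
          (U'.toSpecΓ ≫ Spec.map (CommRingCat.ofHom Inv.subtype) ≫ e.hom) x := by
        rw [he]
      rw [Scheme.Hom.comp_apply, Scheme.Hom.comp_apply, Scheme.Hom.comp_apply] at h
      exact h
    have hZ' : (ρ.pieceMk O).base '' (XO.zeroLocus 𝔞) = e.hom.base ''
        ((Spec.map (CommRingCat.ofHom Inv.subtype)).base ''
          (U'.toSpecΓ.base '' (U'.ι.base ⁻¹' XO.zeroLocus 𝔞))) := by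
      rw [← Set.image_comp, ← Set.image_comp]
      ext z
      constructor
      · rintro ⟨y, hy, rfl⟩
        obtain ⟨x, rfl⟩ := hsurj y
        exact ⟨x, hy, (hcomp x).symm⟩
      · rintro ⟨x, hx, rfl⟩
        exact ⟨U'.ι.base x, hx, hcomp x⟩
    have hT : U'.toSpecΓ.base '' (U'.ι.base ⁻¹' XO.zeroLocus 𝔞) = PrimeSpectrum.zeroLocus 𝔞 := by
      have hpre : U'.toSpecΓ.base ⁻¹' PrimeSpectrum.zeroLocus 𝔞 = U'.ι.base ⁻¹' XO.zeroLocus 𝔞 := by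
        rw [Scheme.Opens.toSpecΓ_preimage_zeroLocus]
        rfl
      rw [← hpre]
      refine Set.image_preimage_eq _ fun y => ⟨hU'aff.isoSpec.inv.base y, ?_⟩
      have h : (hU'aff.isoSpec.inv ≫ hU'aff.isoSpec.hom) y = y := by
        rw [Iso.inv_hom_id]; rfl
      rw [Scheme.Hom.comp_apply, IsAffineOpen.isoSpec_hom] at h
      exact h
    have himg : (Spec.map (CommRingCat.ofHom Inv.subtype)).base '' PrimeSpectrum.zeroLocus 𝔞 =
        PrimeSpectrum.zeroLocus
          (((Ideal.span 𝔞).comap (algebraMap Inv Γ_O) : Ideal Inv) : Set Inv) := by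
      rw [← PrimeSpectrum.zeroLocus_span 𝔞]
      exact image_comap_zeroLocus_eq_of_isIntegral (A := Inv) (B := Γ_O) (Ideal.span 𝔞)
    rw [hZ']
    have hinj : Function.Injective e.hom.base := e.hom.isOpenEmbedding.injective
    have h2 := congrArg (fun A => (Spec.map (CommRingCat.ofHom Inv.subtype)).base '' A) hT
    exact (Set.preimage_image_eq _ hinj).trans (h2.trans himg)
  -- `ψ'⁻¹(𝔞 Γ(O) ∩ Γ(O)^G) = ψ⁻¹(𝔞 Γ(O))`
  have hideal : Ideal.span ((ψ'.symm : Inv →+* R) ''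
      (((Ideal.span 𝔞).comap (algebraMap Inv Γ_O) : Ideal Inv) : Set Inv)) =
      (Ideal.span 𝔞).comap ψ := by
    apply le_antisymm
    · rw [Ideal.span_le]
      rintro _ ⟨y, hy, rfl⟩
      change ψ ((ψ'.symm : Inv →+* R) y) ∈ Ideal.span 𝔞
      have : ψ ((ψ'.symm : Inv →+* R) y) = (y : Γ_O) := by
        rw [← hψ', RingEquiv.coe_toRingHom, RingEquiv.apply_symm_apply]
      rw [this]
      exact hy
    · intro x hx
      refine Ideal.subset_span ⟨ψ' x, ?_, ?_⟩
      · change ((ψ' x : Inv) : Γ_O) ∈ Ideal.span 𝔞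
        rw [hψ']; exact hx
      · change ψ'.symm (ψ' x) = x
        exact ψ'.symm_apply_apply x
  -- conclusion
  change (sR ≫ e.hom).base ⁻¹' _ = _
  rw [Scheme.Hom.comp_base, TopCat.coe_comp, Set.preimage_comp]
  refine (congrArg (fun A => sR.base ⁻¹' A) hZe).trans ?_
  refine (preimage_specMap_base_zeroLocus (ψ'.symm : Inv →+* R) _).trans ?_
  rw [← PrimeSpectrum.zeroLocus_span, hideal]

/-- **The cone-brick transfer, depth two** (see the module docstring). [OURS · L1 W4.5c]
[folklore; assembly of landed decls] -/
theorem exists_isBlowup_depthTwo_of_invariantsPresentation {X S : Scheme.{0}} {r : X ⟶ S}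
    {G : Type} [Group G] [Finite G] (ρ : ActionOver r G) [S.IsSeparated] [IsSeparated r]
    [IsAffine S] (O : ρ.StableAffineOpens) {R : Type} [CommRing R]
    (ψ : R →+* Γ((O.1 : Scheme.{0}), (O.1.ι ≫ r) ⁻¹ᵁ ⊤)) (hψ : Function.Injective ψ)
    (hrange : ψ.range = (ρ.restrict O.1 O.2.1).invariantsRing ⊤)
    (𝔞 : Set Γ((O.1 : Scheme.{0}), (O.1.ι ≫ r) ⁻¹ᵁ ⊤)) (J₀ : Ideal R) (hJ₀ : J₀.IsRadical)
    (hJ : ((Ideal.span 𝔞).comap ψ).radical = J₀)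
    (𝔞' : Set Γ((O.1 : Scheme.{0}), (O.1.ι ≫ r) ⁻¹ᵁ ⊤)) (J₀' : Ideal R)
    (hJ' : ((Ideal.span 𝔞').comap ψ).radical = J₀')
    (C₀ : Closeds (affineBlowup J₀))
    (hC₀ : ∀ x ∈ C₀, (affineBlowup.π J₀).base x ∈ PrimeSpectrum.zeroLocus (J₀' : Set R))
    (hreg₂ : ∃ (B' : Scheme.{0}) (p' : B' ⟶ affineBlowup J₀),
      IsBlowup p' (Scheme.IdealSheafData.vanishingIdeal C₀) ∧ Scheme.IsRegular B')
    (Z : Closeds (ρ.pieceQuot O))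
    (hZ : (Z : Set (ρ.pieceQuot O)) = (ρ.pieceMk O).base '' ((O.1 : Scheme.{0}).zeroLocus 𝔞)) :
    ∃ (B : Scheme.{0}) (pB : B ⟶ ρ.pieceQuot O),
      IsBlowup pB (Scheme.IdealSheafData.vanishingIdeal Z) ∧
      ∃ C : Closeds B,
        pB.base '' (C : Set B) ⊆ (ρ.pieceMk O).base '' ((O.1 : Scheme.{0}).zeroLocus 𝔞') ∧
        ∃ (B' : Scheme.{0}) (pB' : B' ⟶ B),
          IsBlowup pB' (Scheme.IdealSheafData.vanishingIdeal C) ∧ Scheme.IsRegular B' := by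
  classical
  obtain ⟨E, hE⟩ := exists_iso_spec_pieceQuot_zeroLocus ρ O ψ hψ hrange
  -- the preimage of `Z` in `Spec R` is `V(J₀)`
  have hZE : ((Z.preimage E.hom.continuous : Closeds (Spec (CommRingCat.of R))) :
      Set (Spec (CommRingCat.of R))) = PrimeSpectrum.zeroLocus (J₀ : Set R) := by
    rw [Closeds.coe_preimage, hZ, hE 𝔞, ← hJ, PrimeSpectrum.zeroLocus_radical]
  have h𝓘 : (Scheme.IdealSheafData.vanishingIdeal Z).comap E.hom = affineBlowup.idealSheaf J₀ := by
    rw [comap_vanishingIdeal_of_isOpenImmersion]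
    exact vanishingIdeal_eq_idealSheaf_of_isRadical J₀ hJ₀ _ hZE
  refine ⟨affineBlowup J₀, affineBlowup.π J₀ ≫ E.hom, ?_, C₀, ?_, hreg₂⟩
  · have h := (affineBlowup.isBlowup J₀).comp_iso E
    rwa [← h𝓘, ← Scheme.IdealSheafData.comap_comp, E.inv_hom_id,
      Scheme.IdealSheafData.comap_id] at h
  · rintro _ ⟨x, hx, rfl⟩
    have h1 : (affineBlowup.π J₀).base x ∈
        E.hom.base ⁻¹' ((ρ.pieceMk O).base '' ((O.1 : Scheme.{0}).zeroLocus 𝔞')) := by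
      rw [hE 𝔞', ← PrimeSpectrum.zeroLocus_radical, hJ']
      exact hC₀ x hx
    simpa [Scheme.Hom.comp_base] using h1

/-- **Cone brick of depth two from a vertex presentation**: the depth-two twin of
`exists_isBlowup_regular_of_vertexPresentation` (p505172), LITERALLY concluding the binder `HP₀` of
the RUNG V5 scaffold (p527978). Both loci are vertex loci of the blowing up `π : V → Spec S`:
the FIRST centre `π⁻¹V(F₀) ∖ ⋃_{j ∈ κ} V[⊤, y_j]` and the support `π⁻¹V(F₀) ∖ ⋃_{j ∈ κ'} V[⊤, y'_j]`
of the second; the ring brick `H` receives the chart ratios `T_j = π^*y_j/π^*u`,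
`T'_j = π^*y'_j/π^*u` and must deliver `R₀, J₀, J₀', ψ`, the two radical identities, the closed
`C₀ ⊆ Bl_{J₀}(Spec R₀)` over `V(J₀')` and a regular blow-up of `Bl_{J₀}(Spec R₀)` along `𝓘_{C₀}`.
[OURS · L1 W4.5c] [folklore; assembly of landed decls] -/
theorem exists_isBlowup_depthTwo_of_vertexPresentation {S : Type} [CommRing S] {V : Scheme.{0}}
    {π : V ⟶ Spec (CommRingCat.of S)} {I : (Spec (CommRingCat.of S)).IdealSheafData}
    (hπ : IsBlowup π I) {Y : Scheme.{0}} (q : Spec (CommRingCat.of S) ⟶ Y) [IsAffine Y]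
    {G : Type} [Group G] [Finite G] (ρB : ActionOver (π ≫ q) G) [IsSeparated (π ≫ q)]
    {u : Γ(Spec (CommRingCat.of S), ⊤)} (hu : u ∈ I.ideal ⟨⊤, isAffineOpen_top _⟩)
    {κ : Type*} (y : κ → Γ(Spec (CommRingCat.of S), ⊤))
    (hy : ∀ j, y j ∈ I.ideal ⟨⊤, isAffineOpen_top _⟩)
    {κ' : Type*} (y' : κ' → Γ(Spec (CommRingCat.of S), ⊤))
    (hy' : ∀ j, y' j ∈ I.ideal ⟨⊤, isAffineOpen_top _⟩) (F₀ : Set S)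
    (O : ρB.StableAffineOpens) (hO : O.1 ≤ blowupChart π I ⟨⊤, isAffineOpen_top _⟩ u)
    (hle : ((O.1.ι ≫ π ≫ q) ⁻¹ᵁ ⊤ : (O.1 : Scheme.{0}).Opens) ≤
      O.1.ι ⁻¹ᵁ blowupChart π I ⟨⊤, isAffineOpen_top _⟩ u)
    (H : ∀ (T : κ → Γ(V, blowupChart π I ⟨⊤, isAffineOpen_top _⟩ u))
      (T' : κ' → Γ(V, blowupChart π I ⟨⊤, isAffineOpen_top _⟩ u)),
      (∀ j, π.appLE ⊤ (blowupChart π I ⟨⊤, isAffineOpen_top _⟩ u)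
          (blowupChart_le_preimage π I ⟨⊤, isAffineOpen_top _⟩ u) (y j) =
        π.appLE ⊤ (blowupChart π I ⟨⊤, isAffineOpen_top _⟩ u)
          (blowupChart_le_preimage π I ⟨⊤, isAffineOpen_top _⟩ u) u * T j) →
      (∀ j, π.appLE ⊤ (blowupChart π I ⟨⊤, isAffineOpen_top _⟩ u)
          (blowupChart_le_preimage π I ⟨⊤, isAffineOpen_top _⟩ u) (y' j) =
        π.appLE ⊤ (blowupChart π I ⟨⊤, isAffineOpen_top _⟩ u)
          (blowupChart_le_preimage π I ⟨⊤, isAffineOpen_top _⟩ u) u * T' j) →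
      ∃ (R₀ : Type) (_ : CommRing R₀) (J₀ J₀' : Ideal R₀)
        (ψ : R₀ →+* Γ((O.1 : Scheme.{0}), (O.1.ι ≫ π ≫ q) ⁻¹ᵁ ⊤)),
        Function.Injective ψ ∧ ψ.range = (ρB.restrict O.1 O.2.1).invariantsRing ⊤ ∧
        J₀.IsRadical ∧
        ((Ideal.span ((O.1.ι.appLE (blowupChart π I ⟨⊤, isAffineOpen_top _⟩ u)
            ((O.1.ι ≫ π ≫ q) ⁻¹ᵁ ⊤) hle) ''
          ((π.appLE ⊤ (blowupChart π I ⟨⊤, isAffineOpen_top _⟩ u)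
              (blowupChart_le_preimage π I ⟨⊤, isAffineOpen_top _⟩ u)) ''
            ((Scheme.ΓSpecIso (CommRingCat.of S)).inv '' F₀) ∪ Set.range T))).comap ψ).radical = J₀ ∧
        ((Ideal.span ((O.1.ι.appLE (blowupChart π I ⟨⊤, isAffineOpen_top _⟩ u)
            ((O.1.ι ≫ π ≫ q) ⁻¹ᵁ ⊤) hle) ''
          ((π.appLE ⊤ (blowupChart π I ⟨⊤, isAffineOpen_top _⟩ u)
              (blowupChart_le_preimage π I ⟨⊤, isAffineOpen_top _⟩ u)) ''
            ((Scheme.ΓSpecIso (CommRingCat.of S)).inv '' F₀) ∪ Set.range T'))).comap ψ).radical =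
          J₀' ∧
        ∃ C₀ : Closeds (affineBlowup J₀),
          (∀ x ∈ C₀, (affineBlowup.π J₀).base x ∈ PrimeSpectrum.zeroLocus (J₀' : Set R₀)) ∧
          ∃ (B' : Scheme.{0}) (p' : B' ⟶ affineBlowup J₀),
            IsBlowup p' (Scheme.IdealSheafData.vanishingIdeal C₀) ∧ Scheme.IsRegular B')
    (Z : Closeds (ρB.pieceQuot O))
    (hZ : (Z : Set (ρB.pieceQuot O)) = (ρB.pieceMk O).base ''
      (O.1.ι.base ⁻¹' ({v | π.base v ∈ PrimeSpectrum.zeroLocus F₀} \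
        ((⨆ j, blowupChart π I ⟨⊤, isAffineOpen_top _⟩ (y j) : V.Opens) : Set V)))) :
    ∃ (B : Scheme.{0}) (pB : B ⟶ ρB.pieceQuot O),
      IsBlowup pB (Scheme.IdealSheafData.vanishingIdeal Z) ∧
      ∃ C : Closeds B,
        pB.base '' (C : Set B) ⊆ (ρB.pieceMk O).base ''
          (O.1.ι.base ⁻¹' ({v | π.base v ∈ PrimeSpectrum.zeroLocus F₀} \
            ((⨆ j, blowupChart π I ⟨⊤, isAffineOpen_top _⟩ (y' j) : V.Opens) : Set V))) ∧
        ∃ (B' : Scheme.{0}) (pB' : B' ⟶ B),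
          IsBlowup pB' (Scheme.IdealSheafData.vanishingIdeal C) ∧ Scheme.IsRegular B' := by
  classical
  haveI : Y.IsSeparated := inferInstance
  -- the chart ratios
  have hT : ∀ j, ∃ T : Γ(V, blowupChart π I ⟨⊤, isAffineOpen_top _⟩ u),
      π.appLE ⊤ (blowupChart π I ⟨⊤, isAffineOpen_top _⟩ u)
          (blowupChart_le_preimage π I ⟨⊤, isAffineOpen_top _⟩ u) (y j) =
        π.appLE ⊤ (blowupChart π I ⟨⊤, isAffineOpen_top _⟩ u)
          (blowupChart_le_preimage π I ⟨⊤, isAffineOpen_top _⟩ u) u * T :=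
    fun j => hπ.exists_chartRatio ⟨⊤, isAffineOpen_top _⟩ hu (hy j)
  choose T hT using hT
  have hT' : ∀ j, ∃ T : Γ(V, blowupChart π I ⟨⊤, isAffineOpen_top _⟩ u),
      π.appLE ⊤ (blowupChart π I ⟨⊤, isAffineOpen_top _⟩ u)
          (blowupChart_le_preimage π I ⟨⊤, isAffineOpen_top _⟩ u) (y' j) =
        π.appLE ⊤ (blowupChart π I ⟨⊤, isAffineOpen_top _⟩ u)
          (blowupChart_le_preimage π I ⟨⊤, isAffineOpen_top _⟩ u) u * T :=
    fun j => hπ.exists_chartRatio ⟨⊤, isAffineOpen_top _⟩ hu (hy' j)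
  choose T' hT' using hT'
  obtain ⟨R₀, _, J₀, J₀', ψ, hψ, hrange, hJ₀, hJ, hJ', C₀, hC₀, hreg₂⟩ := H T T' hT hT'
  -- both vertex loci seen in `O` are zero loci
  have hU' : ((O.1.ι ≫ π ≫ q) ⁻¹ᵁ ⊤ : (O.1 : Scheme.{0}).Opens) = ⊤ := Scheme.Hom.preimage_top _
  have hZ₁ := hZ
  rw [preimage_ι_vertexLocus_eq_zeroLocus_spec hπ hu y hy T hT F₀ O.1 hO _ hU' hle] at hZ₁
  obtain ⟨B, pB, hpB, C, hC, rest⟩ := exists_isBlowup_depthTwo_of_invariantsPresentation ρB O ψ hψ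
    hrange _ J₀ hJ₀ hJ _ J₀' hJ' C₀ hC₀ hreg₂ Z hZ₁
  refine ⟨B, pB, hpB, C, ?_, rest⟩
  rw [preimage_ι_vertexLocus_eq_zeroLocus_spec hπ hu y' hy' T' hT' F₀ O.1 hO _ hU' hle]
  exact hC

end Summit.ResolutionOfSingularities.ResolutionOfSingularities.Theorems.WildQuotientResolution.BlowupExit

end
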